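import Mathlib.Analysis.SpecialFunctions.Pow.Real
import Mathlib.Data.Set.Card
import Mathlib.Order.Filter.AtTopBot.Basic
import Literature.Computability.Complexity.SymmetricCircuit
import Literature.ModelTheory.FiniteModelTheory.CountingWidth
import HarnessLib

/-!
# From symmetric threshold circuits to counting width (Anderson–Dawar; Dawar–Wilsenach)

Topic `Literature/ModelTheory/FiniteModelTheory`; fact request `wi-09670` of route
`PneNP/SymmetryBudget` (support items `PolylogBarrier`, `PolylogHam`, step (b) of their proof
plans: "supports `≤ k` ⇒ the decided class is closed under `C^{O(k)}`-equivalence"). Two NAMED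
FACTS (D-0014, cited, not proved) connecting symmetric Boolean threshold circuits deciding a class
of graphs to the counting width of that class, typed over the tree's straight-line circuits
(`Literature.Computability.Complexity.Circuit`, `…SymmetricCircuit`: `IsSymmetricUnder`, `IsRigid`,
`Supports`) and the tree's `C^k`-equivalence (`CkEquiv`, Hella's bijective `k`-pebble game) and
`FinGraph = Σ n, SimpleGraph (Fin n)`.

## Sources (read)

* A. Dawar, G. Wilsenach, *Symmetric arithmetic circuits*, Theory of Computing 21 (14) (2025)
  1–32, doi:10.4086/toc.2025.v021a014 [DawarWilsenach2025]. Read: pp. 5–7 (§2.4 Def. 2.1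
  counting width, in Weisfeiler–Leman dimension, "for all graphs `Γ, Δ` of size at most `n`";
  §2.5 bases `𝔹_std = {∧, ∨, ¬}`, `𝔹_t = 𝔹_std ∪ {t_{≥k}}`), pp. 9–10 (§3.2: "the orbit of `g`,
  denoted by `Orb(g)`, is the set of all `h ∈ G` such that there exists an automorphism `π` of `C`
  extending some permutation in `Γ` with `π(g) = h`. We write `ORB(C)` for the maximum size of an
  orbit in `C`, and call it the orbit size of `C`"; square-symmetric = `Sym_n` acting
  simultaneously on rows and columns), pp. 16–18 (§6: Def. 6.1 supports of gates of RIGID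
  symmetric circuits, Thms. 6.2–6.4, Cor. 6.5).
  - p. 17, before Thm. 6.4: "Theorem 6 of [2] asserts that a query on relational structures
    (e.g., a graph property) is decidable by a family of square-symmetric circuits with
    polynomial orbit size if, and only if, it is definable in `C^ω_∞ω` … the proof of
    [2, Theorem 6] establishes this by showing that a circuit of support size `k` translates into
    a formula with `O(k)` variables. **Thus, if a class of graphs `𝒞` is decidable by a family of
    symmetric circuits `(C_n)_{n∈ℕ}` with supports of size at most `k(n)` then `𝒞` has counting
    width `O(k)`.**"
  - **Theorem 6.4.** "Let `𝒞` be a class of graphs decidable by a family of square symmetric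
    Boolean circuits with threshold gates and with orbit size `2^{o(n)}`, then `𝒞` has counting
    width `o(n)`." (p. 18: "The statement of Theorem 6.4 does not make mention of the rigidity
    condition. This suffices, as from [2, Lemma 7] … any symmetric Boolean circuit over the
    threshold basis may be converted into an equivalent rigid symmetric circuit".)
* M. Anderson, A. Dawar, *On symmetric circuits and fixed-point logics*, Theory Comput. Syst. 60
  (2017) 521–551, doi:10.1007/s00224-016-9692-2 [AndersonDawar2016] = [2] above. Read: the arXiv
  text 1401.1125 (§3 supports and the Support Theorem; §4.1 rigid circuits, Lemma 24 = journal
  Lemma 7; §4.3 Claims 27–28: the value of a gate of a rigid symmetric circuit depends only on the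
  image of its support, and is computed by counting over tuples indexed by supports). The journal
  numbering "Theorem 6" is taken from Dawar–Wilsenach's account quoted above; the journal text
  itself was not available to this file's author (paywalled), which is why the supports fact below
  is cited to BOTH sources and stated in the `O(k)` form printed by Dawar–Wilsenach.

## Content

Real definitions (small API proved):
* `adjInput G` — the adjacency matrix of `G : SimpleGraph (Fin n)` as a Boolean input
  `Fin n × Fin n → Bool` (the inputs `x_{ij}` "given the adjacency matrix of a graph `Γ`",
  DW p. 18); `fromRel_adjInput`: the route's reading `SimpleGraph.fromRel (x (u,v) = true)` of
  this input gives back `G`.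
* `Circuit.gateOrbit Γ C j`, `Circuit.orbitSize Γ C` — `Orb(g)` and `ORB(C)` of DW §3.2 for the
  tree's matrix-input circuits (`orbitSize ≤ size`).
* `Circuit.HasSimpleWiring C` — every gate reads pairwise distinct wires (the printed circuits
  are DAGs with an edge RELATION `W ⊆ G × G`, Anderson–Dawar Def. 4 / DW §2.5, whereas a
  straight-line gate may read a wire twice; the facts are stated for simply wired circuits only,
  so as not to exceed print).
* `DecidesGraphClass 𝒞 C` — the family `C : Π n, Circuit (Fin n × Fin n)` decides `𝒞`: on the
  adjacency matrix of every `n`-vertex graph `G`, `C n` outputs `true` iff `⟨n, G⟩ ∈ 𝒞`.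
* `IsCkInvariantAt 𝒞 n k` — on `n`-vertex graphs `𝒞` is a union of `≡^{C^k}`-classes (the
  invariance form of "counting width `≤ k` at `n`"; `isCkInvariantAt_countingWidth` links it to
  the tree's `countingWidth`).
Named facts:
* `DawarWilsenach2025_orbitSize_countingWidth` — **Thm. 6.4**: a class of graphs decided by a
  family of square-symmetric (`IsSymmetricUnder univ`), simply wired threshold (`tcBasis`)
  circuits of orbit size `2^{o(n)}` is, for every `ε > 0` and all large `n`, `≡^{C^k}`-invariant on
  `n`-vertex graphs for every `k ≥ εn` (counting width `o(n)`).
* `AndersonDawar2016_supports_countingWidth` — the supports-to-counting-width transfer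
  (DW p. 17 / proof of AD Thm. 6): if moreover the circuits are rigid and every gate of `C n` has
  a support of size `≤ k(n)` (`Circuit.Supports univ`), then for some constant `c` and all large
  `n`, `𝒞` is `≡^{C^{c·k(n)+c}}`-invariant on `n`-vertex graphs (counting width `O(k)`).
Proved consequences: `.apply` forms; `DecidesGraphClass.mem_iff_of_iso` (a class decided by
symmetric threshold circuits is isomorphism-invariant at each order — symmetry implies
invariance, `Circuit.IsSymmetricUnder.eval_comp_eq`); `isCkInvariantAt_of_le` (with `k ≥ n ≥ 1`
pebbles invariance is automatic, `CkEquiv.nonempty_iso`).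

## Design choices and wording risks

* **Conventions absorbed by constants.** DW's counting width is indexed by Weisfeiler–Leman
  dimension (`≡_k` = `C^{k+1}`), the tree's `CkEquiv k` by the number of variables / pebble
  pairs; DW quantify over graphs of size AT MOST `n`, the facts below over graphs with exactly `n`
  vertices (a weaker conclusion). Both discrepancies are absorbed: in Thm. 6.4 by `o(n)` (the
  conclusion is stated for every `k ≥ εn`, every `ε > 0`, eventually in `n`), in the supports fact
  by the affine form `c·k(n) + c` of "`O(k)`" (which also covers `k(n) = 0`) and by "for all
  large `n`" (`∀ᶠ n in atTop`), exactly the asymptotic content of the printed `O`/`o`.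
* **Orbit size `2^{o(n)}`** is rendered as: for every `ε > 0`, eventually
  `ORB(C_n) ≤ 2^{εn}` (real exponent). DW's `ORB` ranges over ALL gates including the `n²` input
  gates `x_{ij}` (orbits of size `≤ n²`); the tree's inputs are wires, not gates, so `orbitSize`
  maximises over internal gates only — `max(n², orbitSize) = 2^{o(n)}` iff `orbitSize = 2^{o(n)}`,
  so the hypothesis is the printed one.
* **The supports fact is stated for RIGID circuits** (`Circuit.IsRigid`), the only ones for which
  the sources define supports (DW Def. 6.1; AD Def. 11 with Prop. 9), with `Γ = Sym_n`
  (`Set.univ`); for rigid circuits the tree's `Circuit.Supports` (some automorphism extending `ρ`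
  fixes the gate) is the printed notion (the automorphism extending `ρ` is unique). The constant
  `c` is allowed to depend on the class and the family (the printed "`O(k)`" promises no more);
  it does not depend on `n`.
* **Basis.** `tcBasis = {¬, ∧ₖ, ∨ₖ, MAJₖ}` (Anderson–Dawar's majority basis); a `MAJₖ` gate is the
  threshold gate `t_{≥⌈k/2⌉}` on `k` inputs, so `tcBasis`-circuits are circuits "with threshold
  gates" in DW's sense (`𝔹_t ⊇ 𝔹_std`); restricting the hypothesis to `tcBasis` only weakens the
  facts.
* **NOT vendored** (asked for by the work-item "ALSO"): the variant for the point stabiliser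
  `Bud(m, g)` (`pointStabiliserBudget`) with the ordered part of the universe entering as unary /
  nullary relations — this is the route's own, unpublished, transfer step (a), not a citable
  fact; nor the Support Theorem itself (AD Thm. 4 / DW Thm. 6.2) and the orbit–support relation
  (DW Thm. 6.3), which are separate results.
* `lean search 'orbitSize|gateOrbit|DecidesGraphClass|IsCkInvariant'`: nothing in Mathlib or the
  tree; `Circuit.Supports`, `Circuit.gateStabiliser`, `CkEquiv`, `countingWidth`, `FinGraph` are
  reused, not restated.
-/

namespace Literature.ModelTheory.FiniteModelTheory

open Filter Finset
open Literature.Computability.Complexity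

/-! ## Graph inputs of matrix circuits -/

/-- **The adjacency matrix of `G` as a Boolean input** of a circuit on `Fin n × Fin n`:
`x_{uv} = [G.Adj u v]` (symmetric, zero diagonal). This is how a family of square-symmetric
circuits "decides a class of graphs" in Anderson–Dawar 2017, §2 and Dawar–Wilsenach 2025, §6
(p. 18: "the inputs to `Φ_n` are labelled by the variables `x_{ij}` for `i, j ∈ [n]` and, given the
adjacency matrix of a graph `Γ` on its inputs, computes `μ(Γ)`"). [cite: DawarWilsenach2025, §6 (p. 18)] -/
def adjInput {n : ℕ} (G : SimpleGraph (Fin n)) [DecidableRel G.Adj] : Fin n × Fin n → Bool :=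
  fun q => decide (G.Adj q.1 q.2)

/-- Unfolding lemma for `adjInput`. [folklore] -/
@[simp] theorem adjInput_apply {n : ℕ} (G : SimpleGraph (Fin n)) [DecidableRel G.Adj]
    (q : Fin n × Fin n) : adjInput G q = decide (G.Adj q.1 q.2) := rfl

/-- The adjacency input is a symmetric matrix. [folklore] -/
theorem adjInput_swap {n : ℕ} (G : SimpleGraph (Fin n)) [DecidableRel G.Adj] (u v : Fin n) :
    adjInput G (v, u) = adjInput G (u, v) := by
  simp [adjInput, G.adj_comm]

/-- The adjacency input has zero diagonal. [folklore] -/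
theorem adjInput_diag {n : ℕ} (G : SimpleGraph (Fin n)) [DecidableRel G.Adj] (u : Fin n) :
    adjInput G (u, u) = false := by
  simp [adjInput]

/-- Reading the adjacency input back as a graph in the manner of the route `PneNP/SymmetryBudget`
(`Gr x = SimpleGraph.fromRel (x (u, v) = true)`: symmetrised, loops dropped) returns `G`.
[folklore] -/
theorem fromRel_adjInput {n : ℕ} (G : SimpleGraph (Fin n)) [DecidableRel G.Adj] :
    SimpleGraph.fromRel (fun u v : Fin n => adjInput G (u, v) = true) = G := by
  ext u v
  simp only [SimpleGraph.fromRel_adj, adjInput_apply, decide_eq_true_eq]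
  constructor
  · rintro ⟨-, h | h⟩
    · exact h
    · exact h.symm
  · intro h
    exact ⟨h.ne, Or.inl h⟩

/-- Relabelling the vertices along a graph isomorphism `e : G ≃g H` carries the adjacency input of
`H`, precomposed with `e × e` (the permutation `e.toEquiv` of `Fin n`), to that of `G`.
[folklore] -/
theorem adjInput_comp_iso {n : ℕ} {G H : SimpleGraph (Fin n)} [DecidableRel G.Adj]
    [DecidableRel H.Adj] (e : G ≃g H) :
    (fun q : Fin n × Fin n => adjInput H (e.toEquiv q.1, e.toEquiv q.2)) = adjInput G := by
  funext q
  simp only [adjInput_apply]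
  rw [decide_eq_decide]
  exact e.map_rel_iff'

/-! ## Orbits of gates and the orbit size of a matrix circuit (Dawar–Wilsenach §3.2) -/

/-- **The orbit of gate `j`** of a circuit on `m × m` matrix inputs, relative to the set `Γ` of
permutations of `Fin m`: the gates `σ j` for `σ` an automorphism of `C` (`Circuit.IsInducedAut`)
extending the diagonal action of some `ρ ∈ Γ` (Dawar–Wilsenach 2025, §3.2: "the orbit of `g`,
denoted by `Orb(g)`, is the set of all `h ∈ G` such that there exists an automorphism `π` of `C`
extending some permutation in `Γ` with `π(g) = h`"). A dot-notation extension, declared from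
`Literature/ModelTheory`, of the structure `Literature.Computability.Complexity.Circuit`.
[cite: DawarWilsenach2025, §3.2 (Orb(g))] -/
def _root_.Literature.Computability.Complexity.Circuit.gateOrbit {m : ℕ}
    (Γ : Set (Equiv.Perm (Fin m))) (C : Circuit (Fin m × Fin m)) (j : Fin C.gates.length) :
    Set (Fin C.gates.length) :=
  {j' | ∃ ρ ∈ Γ, ∃ σ : Equiv.Perm (Fin C.gates.length),
    C.IsInducedAut (fun q : Fin m × Fin m => (ρ q.1, ρ q.2)) σ ∧ σ j = j'}

/-- **The orbit size `ORB(C)`** of a circuit on matrix inputs relative to `Γ`: the maximum size of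
the orbit of a gate (Dawar–Wilsenach 2025, §3.2: "We write `ORB(C)` for the maximum size of an
orbit in `C`, and call it the orbit size of `C`"); `0` for a circuit without gates.
[cite: DawarWilsenach2025, §3.2 (ORB(C))] -/
noncomputable def _root_.Literature.Computability.Complexity.Circuit.orbitSize {m : ℕ}
    (Γ : Set (Equiv.Perm (Fin m))) (C : Circuit (Fin m × Fin m)) : ℕ :=
  univ.sup fun j : Fin C.gates.length => (C.gateOrbit Γ j).ncard

/-- Membership in the orbit of a gate, unfolded. [folklore] -/
theorem _root_.Literature.Computability.Complexity.Circuit.mem_gateOrbit_iff {m : ℕ}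
    {Γ : Set (Equiv.Perm (Fin m))} {C : Circuit (Fin m × Fin m)} {j j' : Fin C.gates.length} :
    j' ∈ C.gateOrbit Γ j ↔ ∃ ρ ∈ Γ, ∃ σ : Equiv.Perm (Fin C.gates.length),
      C.IsInducedAut (fun q : Fin m × Fin m => (ρ q.1, ρ q.2)) σ ∧ σ j = j' :=
  Iff.rfl

/-- Every gate lies in its own orbit as soon as `1 ∈ Γ` (the identity automorphism extends the
identity permutation). [folklore] -/
theorem _root_.Literature.Computability.Complexity.Circuit.mem_gateOrbit_self {m : ℕ}
    {Γ : Set (Equiv.Perm (Fin m))} (hΓ : (1 : Equiv.Perm (Fin m)) ∈ Γ)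
    (C : Circuit (Fin m × Fin m)) (j : Fin C.gates.length) : j ∈ C.gateOrbit Γ j := by
  refine ⟨1, hΓ, 1, ?_, rfl⟩
  have h : (fun q : Fin m × Fin m => ((1 : Equiv.Perm (Fin m)) q.1, (1 : Equiv.Perm (Fin m)) q.2))
      = _root_.id := by
    funext q
    rfl
  rw [h]
  exact C.isInducedAut_id_one

/-- Orbits are monotone in the set of permutations. [folklore] -/
theorem _root_.Literature.Computability.Complexity.Circuit.gateOrbit_mono {m : ℕ}
    {Γ Γ' : Set (Equiv.Perm (Fin m))} (hΓ : Γ ⊆ Γ') (C : Circuit (Fin m × Fin m))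
    (j : Fin C.gates.length) : C.gateOrbit Γ j ⊆ C.gateOrbit Γ' j := by
  rintro j' ⟨ρ, hρ, σ, hσ, rfl⟩
  exact ⟨ρ, hΓ hρ, σ, hσ, rfl⟩

/-- An orbit has at most as many gates as the circuit. [folklore] -/
theorem _root_.Literature.Computability.Complexity.Circuit.ncard_gateOrbit_le {m : ℕ}
    (Γ : Set (Equiv.Perm (Fin m))) (C : Circuit (Fin m × Fin m)) (j : Fin C.gates.length) :
    (C.gateOrbit Γ j).ncard ≤ C.size := by
  have h := Set.ncard_le_ncard (Set.subset_univ (C.gateOrbit Γ j))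
  rw [Set.ncard_univ, Nat.card_eq_fintype_card, Fintype.card_fin] at h
  exact h

/-- The orbit of every gate is bounded by the orbit size. [folklore] -/
theorem _root_.Literature.Computability.Complexity.Circuit.ncard_gateOrbit_le_orbitSize {m : ℕ}
    (Γ : Set (Equiv.Perm (Fin m))) (C : Circuit (Fin m × Fin m)) (j : Fin C.gates.length) :
    (C.gateOrbit Γ j).ncard ≤ C.orbitSize Γ :=
  le_sup (f := fun j : Fin C.gates.length => (C.gateOrbit Γ j).ncard) (mem_univ j)

/-- **`ORB(C) ≤ |C|`**: the orbit size is at most the size (orbits are sets of gates); in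
particular families of size `2^{o(n)}` have orbit size `2^{o(n)}` (Dawar–Wilsenach 2025, §6, the
remark that size bounds yield orbit-size bounds). [cite: DawarWilsenach2025, §6 (p. 17)] -/
theorem _root_.Literature.Computability.Complexity.Circuit.orbitSize_le_size {m : ℕ}
    (Γ : Set (Equiv.Perm (Fin m))) (C : Circuit (Fin m × Fin m)) : C.orbitSize Γ ≤ C.size :=
  Finset.sup_le fun j _ => C.ncard_gateOrbit_le Γ j

/-- The orbit size is monotone in the set of permutations. [folklore] -/
theorem _root_.Literature.Computability.Complexity.Circuit.orbitSize_mono {m : ℕ}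
    {Γ Γ' : Set (Equiv.Perm (Fin m))} (hΓ : Γ ⊆ Γ') (C : Circuit (Fin m × Fin m)) :
    C.orbitSize Γ ≤ C.orbitSize Γ' :=
  Finset.sup_mono_fun fun j _ =>
    Set.ncard_le_ncard (C.gateOrbit_mono hΓ j) (Set.toFinite _)

/-! ## Simply wired circuits -/

/-- A straight-line circuit is **simply wired** if every gate reads pairwise distinct wires (its
argument map is injective), i.e. the wiring is a RELATION between wires and gates as in the
printed circuit model (Anderson–Dawar 2017, Def. 4: `W ⊆ G × G`; Dawar–Wilsenach 2025, §2.5),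
rather than a multiset. [cite: AndersonDawar2016, Def. 4 (W ⊆ G × G)] -/
def _root_.Literature.Computability.Complexity.Circuit.HasSimpleWiring {ι : Type*}
    (C : Circuit ι) : Prop :=
  ∀ j : Fin C.gates.length, Function.Injective (C.gates[j]).args

/-- Unfolding lemma for `Circuit.HasSimpleWiring`. [folklore] -/
theorem _root_.Literature.Computability.Complexity.Circuit.hasSimpleWiring_iff {ι : Type*}
    (C : Circuit ι) :
    C.HasSimpleWiring ↔ ∀ j : Fin C.gates.length, Function.Injective (C.gates[j]).args :=
  Iff.rfl

/-- The one-gate circuit reading every input through an enumeration (`Circuit.single`, symmetric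
under every permutation) is simply wired: its gate reads the distinct wires `Sum.inl (e a)`
(non-vacuity of `HasSimpleWiring` within the symmetric circuits). [folklore] -/
theorem _root_.Literature.Computability.Complexity.Circuit.hasSimpleWiring_single {ι : Type*}
    (f : GateFn) (e : Fin f.1 ≃ ι) : (Circuit.single f e).HasSimpleWiring := by
  rintro ⟨j, hj⟩
  have hj0 : j = 0 := by
    simp only [Circuit.single, List.length_singleton] at hj
    omega
  subst hj0
  intro a b hab
  have hab' : (Sum.inl (e a) : ι ⊕ ℕ) = Sum.inl (e b) := hab
  exact e.injective (Sum.inl_injective hab')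

/-! ## Deciding a class of graphs; `C^k`-invariance at an order -/

/-- The family `C = (C_n)` of circuits on `n × n` matrix inputs **decides the class `𝒞` of finite
graphs**: for every `n` and every graph `G` on `Fin n`, `C_n` outputs `true` on the adjacency matrix
of `G` iff `⟨n, G⟩ ∈ 𝒞` (Dawar–Wilsenach 2025, §2.4 and §6, p. 18; Anderson–Dawar 2017, §2.2,
circuits deciding a graph property). The value of `decide` does not depend on the decidability
instance. [cite: DawarWilsenach2025, §6 (p. 18)] -/
def DecidesGraphClass (𝒞 : Set FinGraph) (C : ∀ n : ℕ, Circuit (Fin n × Fin n)) : Prop :=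
  ∀ (n : ℕ) (G : SimpleGraph (Fin n)) [DecidableRel G.Adj],
    (C n).eval (adjInput G) = true ↔ (⟨n, G⟩ : FinGraph) ∈ 𝒞

/-- **`𝒞` is `≡^{C^k}`-invariant on `n`-vertex graphs**: `C^k`-equivalent graphs on `Fin n` are
both in `𝒞` or both outside — on `n`-vertex graphs `𝒞` is a union of `≡^{C^k}`-classes,
equivalently definable there by a `C^k`-sentence (Hella's theorem; Atserias–Dawar 2019, §2.1),
i.e. "counting width at most `k` at order `n`" in the exact-order form. [cite: AtseriasDawar2019, §2.1] -/
def IsCkInvariantAt (𝒞 : Set FinGraph) (n k : ℕ) : Prop :=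
  ∀ G H : SimpleGraph (Fin n), CkEquiv k G H → ((⟨n, G⟩ : FinGraph) ∈ 𝒞 ↔ (⟨n, H⟩ : FinGraph) ∈ 𝒞)

/-- Invariance under a coarser equivalence gives invariance under every finer one (`CkEquiv` is
antitone in `k`). [folklore] -/
theorem IsCkInvariantAt.mono {𝒞 : Set FinGraph} {n k k' : ℕ} (h : IsCkInvariantAt 𝒞 n k)
    (hk : k ≤ k') : IsCkInvariantAt 𝒞 n k' :=
  fun G H hGH => h G H (hGH.mono hk)

/-- At the counting width itself an isomorphism-closed class is invariant on `n`-vertex graphs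
(`n ≥ 1`; `countingWidth_induction`). [cite: AtseriasDawar2019, §2.1] -/
theorem isCkInvariantAt_countingWidth {𝒞 : Set FinGraph} (h𝒞 : IsIsoClosed 𝒞) {n : ℕ}
    (hn : 1 ≤ n) : IsCkInvariantAt 𝒞 n (countingWidth 𝒞 n) :=
  countingWidth_induction h𝒞 hn (P := fun k => IsCkInvariantAt 𝒞 n k) fun _ hk => hk

/-! ## The named facts -/

/-- NAMED FACT — **Dawar–Wilsenach 2025, Theorem 6.4 (orbit size `2^{o(n)}` ⇒ counting width
`o(n)`)**: "Let `𝒞` be a class of graphs decidable by a family of square symmetric Boolean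
circuits with threshold gates and with orbit size `2^{o(n)}`, then `𝒞` has counting width `o(n)`."
Rendered for the tree's straight-line circuits: let `C = (C_n)` be a family of simply wired
(`HasSimpleWiring`) circuits over the threshold basis `tcBasis` on `n × n` matrix inputs, each
`C_n` symmetric under the simultaneous action of the full symmetric group `Sym(Fin n)` on rows and
columns (`IsSymmetricUnder univ`; rigidity NOT assumed, as printed), deciding `𝒞` on adjacency
matrices (`DecidesGraphClass`), and of orbit size `2^{o(n)}` — for every `ε > 0`, eventually
`ORB(C_n) ≤ 2^{εn}` (`Circuit.orbitSize univ`). Then `𝒞` has counting width `o(n)`, in the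
invariance form: for every `ε > 0` and all sufficiently large `n`, `𝒞` is `≡^{C^k}`-invariant on
`n`-vertex graphs for every `k ≥ εn` (`IsCkInvariantAt`; the `+1` between Weisfeiler–Leman
dimension and number of variables, and "graphs of size at most `n`" versus exactly `n`, only
weaken this conclusion — module docstring). Proof in the source: [2, Lemma 7] (rigidification
without increase of orbit size), the Support Theorem (Thm. 6.2) giving supports of size `o(n)`
(Thm. 6.3), and the supports-to-`C^{O(k)}` translation of [2, Thm. 6]
(`AndersonDawar2016_supports_countingWidth`). [cite: DawarWilsenach2025, Thm. 6.4 (p. 17)] -/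
def DawarWilsenach2025_orbitSize_countingWidth : Prop :=
  ∀ (𝒞 : Set FinGraph) (C : ∀ n : ℕ, Circuit (Fin n × Fin n)),
    (∀ n, (C n).IsOver tcBasis ∧ (C n).IsSymmetricUnder Set.univ ∧ (C n).HasSimpleWiring) →
    DecidesGraphClass 𝒞 C →
    (∀ ε : ℝ, 0 < ε → ∀ᶠ n : ℕ in atTop, ((C n).orbitSize Set.univ : ℝ) ≤ (2 : ℝ) ^ (ε * (n : ℝ))) →
    ∀ ε : ℝ, 0 < ε → ∀ᶠ n : ℕ in atTop, ∀ k : ℕ, ε * (n : ℝ) ≤ (k : ℝ) → IsCkInvariantAt 𝒞 n k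

/-- NAMED FACT — **supports of size `k` give counting width `O(k)`** (Anderson–Dawar 2017, Thm. 6
and its proof — "a circuit of support size `k` translates into a formula with `O(k)` variables"
— as packaged by Dawar–Wilsenach 2025, §6, p. 17: "if a class of graphs `𝒞` is decidable by a
family of symmetric circuits `(C_n)_{n∈ℕ}` with supports of size at most `k(n)` then `𝒞` has
counting width `O(k)`"; there for rigid square-symmetric Boolean circuits over the threshold
basis, the setting of their Def. 6.1 and Thm. 6.3). Rendered: let `k : ℕ → ℕ` and let
`C = (C_n)` be a family of simply wired, RIGID (`Circuit.IsRigid`) `tcBasis`-circuits on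
`n × n` matrix inputs, `Sym(Fin n)`-symmetric (`IsSymmetricUnder univ`), deciding `𝒞` on adjacency
matrices, such that every gate of `C_n` has a support of size at most `k(n)` — a set `S ⊆ Fin n`,
`|S| ≤ k(n)`, with `Stab(S) ≤ Stab(g)` (`Circuit.Supports univ S g`: every permutation fixing `S`
pointwise extends to an automorphism fixing `g`; for rigid circuits the extension is unique and
this is Def. 6.1 / AD Def. 11). Then there is a constant `c` (depending on `𝒞` and the family,
not on `n`) such that for all sufficiently large `n`, `𝒞` is `≡^{C^{c·k(n)+c}}`-invariant on
`n`-vertex graphs (`IsCkInvariantAt`). The affine form `c·k + c` and the eventual quantifier are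
the content of the printed `O(k)` (module docstring). [cite: DawarWilsenach2025, §6 p. 17 (supports ⇒ counting width O(k)); AndersonDawar2016 Thm. 6 (proof)] -/
def AndersonDawar2016_supports_countingWidth : Prop :=
  ∀ (𝒞 : Set FinGraph) (k : ℕ → ℕ) (C : ∀ n : ℕ, Circuit (Fin n × Fin n)),
    (∀ n, (C n).IsOver tcBasis ∧ (C n).IsSymmetricUnder Set.univ ∧ (C n).IsRigid ∧
      (C n).HasSimpleWiring ∧
      ∀ j : Fin (C n).gates.length, ∃ S : Finset (Fin n), S.card ≤ k n ∧
        (C n).Supports Set.univ (S : Set (Fin n)) j) →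
    DecidesGraphClass 𝒞 C →
    ∃ c : ℕ, ∀ᶠ n : ℕ in atTop, IsCkInvariantAt 𝒞 n (c * k n + c)

/-! ## Hypothesis forms and proved consequences -/

/-- **Dawar–Wilsenach 2025, Thm. 6.4, hypothesis form.** Tautological unfolding of the named fact.
[folklore] -/
theorem DawarWilsenach2025_orbitSize_countingWidth.apply
    (h : DawarWilsenach2025_orbitSize_countingWidth) {𝒞 : Set FinGraph}
    {C : ∀ n : ℕ, Circuit (Fin n × Fin n)}
    (hC : ∀ n, (C n).IsOver tcBasis ∧ (C n).IsSymmetricUnder Set.univ ∧ (C n).HasSimpleWiring)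
    (hdec : DecidesGraphClass 𝒞 C)
    (horb : ∀ ε : ℝ, 0 < ε →
      ∀ᶠ n : ℕ in atTop, ((C n).orbitSize Set.univ : ℝ) ≤ (2 : ℝ) ^ (ε * (n : ℝ)))
    {ε : ℝ} (hε : 0 < ε) :
    ∀ᶠ n : ℕ in atTop, ∀ k : ℕ, ε * (n : ℝ) ≤ (k : ℝ) → IsCkInvariantAt 𝒞 n k :=
  h 𝒞 C hC hdec horb ε hε

/-- **Supports ⇒ counting width, hypothesis form.** Tautological unfolding of the named fact.
[folklore] -/
theorem AndersonDawar2016_supports_countingWidth.apply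
    (h : AndersonDawar2016_supports_countingWidth) {𝒞 : Set FinGraph} {k : ℕ → ℕ}
    {C : ∀ n : ℕ, Circuit (Fin n × Fin n)}
    (hC : ∀ n, (C n).IsOver tcBasis ∧ (C n).IsSymmetricUnder Set.univ ∧ (C n).IsRigid ∧
      (C n).HasSimpleWiring ∧
      ∀ j : Fin (C n).gates.length, ∃ S : Finset (Fin n), S.card ≤ k n ∧
        (C n).Supports Set.univ (S : Set (Fin n)) j)
    (hdec : DecidesGraphClass 𝒞 C) :
    ∃ c : ℕ, ∀ᶠ n : ℕ in atTop, IsCkInvariantAt 𝒞 n (c * k n + c) :=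
  h 𝒞 k C hC hdec

/-- **A class decided by symmetric threshold circuits is isomorphism-invariant at each order**:
if `C_n` is `Sym(Fin n)`-symmetric over `tcBasis` and decides `𝒞` on adjacency matrices, then
isomorphic graphs on `Fin n` are both in `𝒞` or both outside (symmetry implies invariance,
Anderson–Dawar 2017, §2.2 — `Circuit.IsSymmetricUnder.eval_comp_eq` — applied to the permutation
underlying the isomorphism). A sanity consequence of the hypotheses shared by both facts.
[cite: AndersonDawar2016, §2.2 (symmetry implies invariance)] -/
theorem DecidesGraphClass.mem_iff_of_iso {𝒞 : Set FinGraph} {C : ∀ n : ℕ, Circuit (Fin n × Fin n)}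
    (hdec : DecidesGraphClass 𝒞 C) {n : ℕ} (hB : (C n).IsOver tcBasis)
    (hsym : (C n).IsSymmetricUnder Set.univ) {G H : SimpleGraph (Fin n)} (e : G ≃g H) :
    (⟨n, G⟩ : FinGraph) ∈ 𝒞 ↔ (⟨n, H⟩ : FinGraph) ∈ 𝒞 := by
  classical
  rw [← hdec n G, ← hdec n H, ← adjInput_comp_iso e]
  rw [hsym.eval_comp_eq (fun g hg => isSymmetric_of_mem_tcBasis (hB g hg)) (Set.mem_univ _)]

/-- With at least `n ≥ 1` pebble pairs, `≡^{C^k}` on `n`-vertex graphs is isomorphism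
(`CkEquiv.nonempty_iso`), so a class decided by `Sym(Fin n)`-symmetric threshold circuits is
automatically `≡^{C^k}`-invariant at order `n` for every `k ≥ n`: the facts above have content
only for `k < n` (Dawar–Wilsenach 2025, §2.4, "`ν(n) ≤ n`"). [cite: DawarWilsenach2025, §2.4] -/
theorem DecidesGraphClass.isCkInvariantAt_of_le {𝒞 : Set FinGraph}
    {C : ∀ n : ℕ, Circuit (Fin n × Fin n)} (hdec : DecidesGraphClass 𝒞 C) {n k : ℕ}
    (hB : (C n).IsOver tcBasis) (hsym : (C n).IsSymmetricUnder Set.univ) (hn : 1 ≤ n)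
    (hnk : n ≤ k) : IsCkInvariantAt 𝒞 n k := by
  intro G H hGH
  obtain ⟨e⟩ := hGH.nonempty_iso (by omega) (by simpa using hnk)
  exact hdec.mem_iff_of_iso hB hsym e

end Literature.ModelTheory.FiniteModelTheory
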